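import Summits.QuantumFields.YangMills.Theorems.CurvatureBoostCovariance.Negative.BetaZeroTie

/-!
# `HypercubicLimit` — negative-side support: every witness scheme must leave `β = 0`

Support file for crux `stmt-QuantumFields-8646` (`HypercubicLimit`, shared by routes PencilRigidity /
MirrorModularBoosts / CoincidenceRotationBootstrap), extracted from the standing disprover's work file
`Cruxes/HypercubicLimit/Disproof.lean` §9 (cycle 3).  It combines the landed `β ≡ 0` collapse of the sibling
crux (`CurvatureBoostCovariance/Negative/BetaZeroTie.lean`: at a step with `β_k = 0` the curvature is an exact
c-number field on off-diagonal real tensors, whatever `c_k, m_k, a_k, L_k`) with the real→complex bridge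
`NonTrivialityBridge.not_twoPointNontrivial_of_factorizes`:

* `factorizes_of_frequently_beta_zero`: `β_k = 0` frequently + the convergence clause ⇒ the curvature two-point
  function factorises on every off-diagonal real tensor;
* `not_twoPointNontrivial_of_frequently_beta_zero`: … hence the crux's non-triviality clause fails;
* `eventually_beta_ne_zero_of_converges_nontrivial`: **a witness of `Converges ∧ TwoPointNontrivial` (in particular
  any witness of the crux) has `β_k ≠ 0` for all large `k`** — any proof must move the coupling off the
  strong-coupling fixed point, where (`LatticeGapOnTrajectory/Negative/ZeroCouplingGap.lean`) the uniform
  lattice-gap clause is free. [folklore]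
-/

noncomputable section

open scoped SchwartzMap
open MeasureTheory Filter Topology
open Literature.MathematicalPhysics.AQFT Literature.MathematicalPhysics.QuantumLattice
open Literature.MathematicalPhysics.QuantumFieldTheory

namespace Summit.QuantumFields.YangMills.Theorems.HypercubicLimit.Negative

section BetaZero

variable {G : Type} [Group G] [TopologicalSpace G] [IsTopologicalGroup G] [CompactSpace G]
  [MeasurableSpace G] [BorelSpace G]

/-- `tensor₁ w` is the tensor of the constant string `w`. [folklore] -/
theorem isTensorOf_tensor₁_const (w : 𝓢((EuclideanSpace ℝ (Fin 4)), ℝ)) :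
    IsTensorOf (tensor₁ w) (fun _ => ofRealTest w) := by
  intro x
  rw [isTensorOf_tensor₁ w x]
  simp

/-- **`β_k = 0` frequently ⇒ the curvature two-point function factorises on every off-diagonal real tensor**
(from the convergence clause of the curvature string alone; any `c_k, m_k, a_k, L_k`, any faithful `r`). [folklore] -/
theorem factorizes_of_frequently_beta_zero (r : LatticeRep G) (sch : SpeciesScheme (YMSpecies G))
    (S : LabelledSchwingerFamily (YMSpecies G) (EuclideanSpace ℝ (Fin 4)))
    (hβ : ∃ᶠ k in atTop, sch.β k = 0)
    (hconv : ∀ (n : ℕ), n ≠ 0 → ∀ (f : Fin n → 𝓢((EuclideanSpace ℝ (Fin 4)), ℝ))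
      (F : 𝓢((Fin n → EuclideanSpace ℝ (Fin 4)), ℂ)), IsTensorOf F (fun i => ofRealTest (f i)) →
      IsOffDiagonal F → Tendsto (fun k : ℕ => ((latticeSchwinger r.ρ sch (fun s => s.F) k n
        (fun _ => r.curvature) f : ℝ) : ℂ)) atTop (𝓝 (S n (fun _ => r.curvature) F)))
    (u v : 𝓢((EuclideanSpace ℝ (Fin 4)), ℝ)) (hod : IsOffDiagonal (tensor₂ u v)) :
    S (1 + 1) (fun _ => r.curvature) (tensor₂ u v) =
      S 1 (fun _ => r.curvature) (tensor₁ u) * S 1 (fun _ => r.curvature) (tensor₁ v) := by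
  have h := CurvatureBoostCovariance.Negative.tie_beta_zero_factorises r sch hβ
    (S₁ := fun n => S n (fun _ => r.curvature)) hconv (n := 1 + 1) (by norm_num)
    ![u, v] (tensor₂ u v) (isTensorOf_tensor₂ u v) hod ![tensor₁ u, tensor₁ v]
    (fun i => by fin_cases i <;> simpa using isTensorOf_tensor₁_const _)
  rw [h, Fin.prod_univ_two]
  rfl

/-- **`β_k = 0` frequently kills the non-triviality clause of the crux** (every `c_k, m_k, a_k, L_k`, every
faithful `r`; only the curvature string of the convergence clause is used). [folklore] -/
theorem not_twoPointNontrivial_of_frequently_beta_zero (r : LatticeRep G)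
    (sch : SpeciesScheme (YMSpecies G)) (S : LabelledSchwingerFamily (YMSpecies G) (EuclideanSpace ℝ (Fin 4)))
    (hβ : ∃ᶠ k in atTop, sch.β k = 0)
    (hconv : ∀ (n : ℕ), n ≠ 0 → ∀ (f : Fin n → 𝓢((EuclideanSpace ℝ (Fin 4)), ℝ))
      (F : 𝓢((Fin n → EuclideanSpace ℝ (Fin 4)), ℂ)), IsTensorOf F (fun i => ofRealTest (f i)) →
      IsOffDiagonal F → Tendsto (fun k : ℕ => ((latticeSchwinger r.ρ sch (fun s => s.F) k n
        (fun _ => r.curvature) f : ℝ) : ℂ)) atTop (𝓝 (S n (fun _ => r.curvature) F))) :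
    ¬ (∃ (F₁ G₁ : 𝓢((Fin 1 → (EuclideanSpace ℝ (Fin 4))), ℂ))
        (H₁ : 𝓢((Fin (1 + 1) → (EuclideanSpace ℝ (Fin 4))), ℂ)),
      IsTimeOrdered F₁ ∧ IsTimeOrdered G₁ ∧ IsAppendTensorOf H₁ (osAdjoint F₁) G₁ ∧
        S (1 + 1) (fun _ => r.curvature) H₁ ≠
          S 1 (fun _ => r.curvature) (osAdjoint F₁) * S 1 (fun _ => r.curvature) G₁) :=
  not_twoPointNontrivial_of_factorizes S r.curvature fun u v hu hv =>
    factorizes_of_frequently_beta_zero r sch S hβ hconv u v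
      (isOffDiagonal_of_halfSpaces hu hv (isTensorOf_tensor₂ u v))

/-- **Any proof must move the coupling off zero**: a triple `(r, sch, S)` whose curvature string converges
along `sch` (the crux's `IsYangMillsFor` clause restricted to the curvature) and whose curvature species is
non-trivial has `β_k ≠ 0` for all large `k`. [folklore] -/
theorem eventually_beta_ne_zero_of_converges_nontrivial (r : LatticeRep G)
    (sch : SpeciesScheme (YMSpecies G)) (S : LabelledSchwingerFamily (YMSpecies G) (EuclideanSpace ℝ (Fin 4)))
    (hconv : ∀ (n : ℕ), n ≠ 0 → ∀ (f : Fin n → 𝓢((EuclideanSpace ℝ (Fin 4)), ℝ))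
      (F : 𝓢((Fin n → EuclideanSpace ℝ (Fin 4)), ℂ)), IsTensorOf F (fun i => ofRealTest (f i)) →
      IsOffDiagonal F → Tendsto (fun k : ℕ => ((latticeSchwinger r.ρ sch (fun s => s.F) k n
        (fun _ => r.curvature) f : ℝ) : ℂ)) atTop (𝓝 (S n (fun _ => r.curvature) F)))
    (hnt : ∃ (F₁ G₁ : 𝓢((Fin 1 → (EuclideanSpace ℝ (Fin 4))), ℂ))
        (H₁ : 𝓢((Fin (1 + 1) → (EuclideanSpace ℝ (Fin 4))), ℂ)),
      IsTimeOrdered F₁ ∧ IsTimeOrdered G₁ ∧ IsAppendTensorOf H₁ (osAdjoint F₁) G₁ ∧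
        S (1 + 1) (fun _ => r.curvature) H₁ ≠
          S 1 (fun _ => r.curvature) (osAdjoint F₁) * S 1 (fun _ => r.curvature) G₁) :
    ∀ᶠ k in atTop, sch.β k ≠ 0 := by
  by_contra hne
  rw [Filter.not_eventually] at hne
  exact not_twoPointNontrivial_of_frequently_beta_zero r sch S (hne.mono fun k hk => not_not.1 hk)
    hconv hnt

/-- **Every witness of `HypercubicLimit` has `β_k ≠ 0` eventually** (the crux, if true, is witnessed only by
schemes leaving the strong-coupling fixed point). [folklore] -/
theorem hypercubicLimit_witness_beta_ne_zero
    (h : Summit.QuantumFields.YangMills.Theses.PencilRigidity.HypercubicLimit)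
    (G : Type) [Group G] [TopologicalSpace G] [IsTopologicalGroup G] [CompactSpace G]
    (hG : IsCompactSimpleLieGroup G) :
    letI : MeasurableSpace G := borel G
    haveI : BorelSpace G := ⟨rfl⟩
    ∃ (r : LatticeRep G) (sch : SpeciesScheme (YMSpecies G)), (∀ᶠ k in atTop, sch.β k ≠ 0) ∧
      ∃ S : LabelledSchwingerFamily (YMSpecies G) (EuclideanSpace ℝ (Fin 4)),
        ∀ (n : ℕ), n ≠ 0 → ∀ (σ : Fin n → YMSpecies G) (f : Fin n → 𝓢((EuclideanSpace ℝ (Fin 4)), ℝ))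
          (F : 𝓢((Fin n → EuclideanSpace ℝ (Fin 4)), ℂ)), IsTensorOf F (fun i => ofRealTest (f i)) →
          IsOffDiagonal F → Tendsto (fun k : ℕ => ((latticeSchwinger r.ρ sch (fun s => s.F) k n σ f : ℝ) : ℂ))
            atTop (𝓝 (S n σ F)) := by
  letI : MeasurableSpace G := borel G
  haveI : BorelSpace G := ⟨rfl⟩
  obtain ⟨r, sch, S, _, hconv, hnt, _, _⟩ := h G hG
  exact ⟨r, sch, eventually_beta_ne_zero_of_converges_nontrivial r sch S
    (fun n hn f F hF hF' => hconv n hn (fun _ => r.curvature) f F hF hF') hnt, S, hconv⟩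

end BetaZero

end Summit.QuantumFields.YangMills.Theorems.HypercubicLimit.Negative

end
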